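import Literature.MathematicalPhysics.KineticTheory.HardSphereEuler
import Literature.Analysis.FunctionSpaces.FlatTorus
import Summits.AtomisticToContinuum.HydrodynamicLimit.Theses.TwoClocks

/-!
# `EquilibriumShearWindowLD` (route TwoClocks, support item stmt-AtomisticToContinuum-14446): reductions

The support item `TwoClocks.EquilibriumShearWindowLD` — the finite-kinetic-window large-deviation
upper bound for the kinetic shear stress `F(x,v) = φ(x) v⁰ v¹` of `N + 1` hard spheres at fixed small
reduced density `σ³`, started from the global canonical Gibbs law with `u₀ = 0` — is the
"cheapest typed rung" of the route: it is *literally an instance* of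

* the route's crux `Theses.TwoClocks.EquilibriumFastWindowLD` (stmt-AtomisticToContinuum-14440: all
  continuous one-body functionals of quadratic growth orthogonal to the collision invariants), with
  `u₀ = 0`, `F(x,v) = φ(x) v⁰ v¹`;
* the route's docking node `TwoClocks.KineticWindowLDUniform` (stmt-AtomisticToContinuum-14442:
  local Gibbs data, uniform over dilute profiles `σ³ · sup a ≤ η₀ ∫ a`), at constant profiles
  `a ≡ a₀`, `θ ≡ θ₀`, `u ≡ 0` — the packing guard then reads `σ³ ≤ η₀`, so `σ₀ := min 1 η₀` works;
* (companion file `TwoClocksEquilibriumShearWindowLDGossip.lean`) the sibling docking node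
  `OneFlightGossipEngine.KineticCurrentsWindowLDUniform` (stmt-AtomisticToContinuum-14662).

This file proves the first two implications (`equilibriumShearWindowLD_of_equilibriumFastWindowLD`,
`equilibriumShearWindowLD_of_kineticWindowLDUniform`), so that the item closes the moment either node
lands. The mathematical content of the instantiation is:

* the three ORTHOGONALITY clauses — `φ(x) v⁰ v¹` is orthogonal under the centred Maxwellian
  `M_{1,0,θ₀}` to `1`, to every `v_j` and to `|v|²` — proved by the velocity reflections
  `v_k ↦ -v_k` (`exists_velFlip k`: a linear isometry of `ℝ³`, hence Lebesgue-measure preserving,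
  `MeasureTheory.integral_comp`): each integrand is odd under the reflection of `v⁰` or of `v¹`
  while the centred Maxwellian is even (`integral_eq_zero_of_odd_linearIsometryEquiv`); no Gaussian
  moment is computed and no integrability is needed;
* the QUADRATIC GROWTH `|φ(x) v⁰ v¹| ≤ ‖φ‖_∞ (1 + |v|²)` (`φ` is bounded on the compact torus,
  `|v⁰ v¹| ≤ |v|²`) and continuity.

The item itself (fixed-density, kinetically-long-window exponential moments for the deterministic
hard-sphere gas) is an open problem; nothing here claims it.

prover-pitem-stmt-AtomisticToContinuum-14446-0.
-/

noncomputable section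

open MeasureTheory Filter Topology Set
open scoped ENNReal

namespace Summit.AtomisticToContinuum.HydrodynamicLimit.Theorems

open Literature.MathematicalPhysics.KineticTheory (T3 V3 hsDiameter localGibbsLaw)
open Literature.Analysis.FluidPDE (localMaxwellian HardSphereFlow)

/-! ### Velocity reflections and odd Maxwellian moments -/

/-- **The coordinate reflections of velocity space exist as linear isometries.** For each
`k : Fin 3` there is a linear isometry equivalence `R` of `ℝ³` with `(R v)_k = -v_k` and
`(R v)_i = v_i` for `i ≠ k` (the coordinatewise `LinearIsometryEquiv.piLpCongrRight` of `neg` at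
`k` and `refl` elsewhere). Stated as an existence theorem so that this proof file introduces no
definition. [folklore] -/
theorem exists_velFlip (k : Fin 3) :
    ∃ R : V3 ≃ₗᵢ[ℝ] V3, ∀ (v : V3) (i : Fin 3), R v i = if i = k then -v i else v i := by
  refine ⟨LinearIsometryEquiv.piLpCongrRight 2 fun i =>
    if i = k then LinearIsometryEquiv.neg ℝ (E := ℝ) else LinearIsometryEquiv.refl ℝ ℝ,
    fun v i => ?_⟩
  rw [LinearIsometryEquiv.piLpCongrRight_apply, PiLp.toLp_apply]
  split_ifs with h
  · simp
  · simp

/-- The centred Maxwellian `M_{1,0,θ}` is invariant under every linear isometry of velocity space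
(it is a function of the speed). [folklore] -/
theorem localMaxwellian_linearIsometryEquiv (θ : ℝ) (R : V3 ≃ₗᵢ[ℝ] V3) (v : V3) :
    localMaxwellian 1 θ (0 : V3) (R v) = localMaxwellian 1 θ (0 : V3) v := by
  simp only [Literature.Analysis.FluidPDE.localMaxwellian, sub_zero, LinearIsometryEquiv.norm_map]

/-- **Odd functions integrate to zero.** If `g ∘ R = -g` for a linear isometry equivalence `R` of
`ℝ³` then `∫ g dv = 0`: `R` preserves Lebesgue measure (`MeasureTheory.integral_comp`), so
`∫ g = ∫ g ∘ R = -∫ g`. No integrability hypothesis (both sides are the Bochner integral, junk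
value `0` included). [folklore] -/
theorem integral_eq_zero_of_odd_linearIsometryEquiv {g : V3 → ℝ} (R : V3 ≃ₗᵢ[ℝ] V3)
    (hg : ∀ v, g (R v) = -g v) : ∫ v, g v = 0 := by
  have h1 : ∫ v, g (R v) = ∫ v, g v := MeasureTheory.integral_comp R g
  have h2 : ∫ v, g (R v) = -∫ v, g v := by
    rw [← integral_neg]
    exact integral_congr_ae (ae_of_all _ hg)
  linarith

/-- `(1 : Fin 3) ≠ 0`. [folklore] -/
private theorem fin3_one_ne_zero : (1 : Fin 3) ≠ 0 := by decide

/-- The kinetic shear stress `c · v⁰ v¹` is orthogonal to the constants under the centred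
Maxwellian (odd under `v⁰ ↦ -v⁰`). [folklore] -/
theorem integral_shear_mul_localMaxwellian (c θ : ℝ) :
    ∫ v : V3, c * (v 0 * v 1) * localMaxwellian 1 θ (0 : V3) v = 0 := by
  obtain ⟨R, hR⟩ := exists_velFlip 0
  refine integral_eq_zero_of_odd_linearIsometryEquiv R fun v => ?_
  rw [localMaxwellian_linearIsometryEquiv, hR v 0, hR v 1, if_pos rfl, if_neg fin3_one_ne_zero]
  ring

/-- The kinetic shear stress `c · v⁰ v¹` is orthogonal to every velocity component `v_j` under the
centred Maxwellian (odd under `v¹ ↦ -v¹` if `j = 0`, under `v⁰ ↦ -v⁰` otherwise). [folklore] -/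
theorem integral_shear_mul_vel_mul_localMaxwellian (c θ : ℝ) (j : Fin 3) :
    ∫ v : V3, c * (v 0 * v 1) * v j * localMaxwellian 1 θ (0 : V3) v = 0 := by
  by_cases hj : j = 0
  · subst hj
    obtain ⟨R, hR⟩ := exists_velFlip 1
    refine integral_eq_zero_of_odd_linearIsometryEquiv R fun v => ?_
    rw [localMaxwellian_linearIsometryEquiv, hR v 0, hR v 1, if_pos rfl,
      if_neg fin3_one_ne_zero.symm]
    ring
  · obtain ⟨R, hR⟩ := exists_velFlip 0
    refine integral_eq_zero_of_odd_linearIsometryEquiv R fun v => ?_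
    rw [localMaxwellian_linearIsometryEquiv, hR v 0, hR v 1, hR v j, if_pos rfl,
      if_neg fin3_one_ne_zero, if_neg hj]
    ring

/-- The kinetic shear stress `c · v⁰ v¹` is orthogonal to the kinetic energy `|v|²` under the
centred Maxwellian (odd under `v⁰ ↦ -v⁰`, the speed being invariant). [folklore] -/
theorem integral_shear_mul_norm_sq_mul_localMaxwellian (c θ : ℝ) :
    ∫ v : V3, c * (v 0 * v 1) * ‖v‖ ^ 2 * localMaxwellian 1 θ (0 : V3) v = 0 := by
  obtain ⟨R, hR⟩ := exists_velFlip 0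
  refine integral_eq_zero_of_odd_linearIsometryEquiv R fun v => ?_
  rw [localMaxwellian_linearIsometryEquiv, hR v 0, hR v 1, if_pos rfl, if_neg fin3_one_ne_zero,
    LinearIsometryEquiv.norm_map]
  ring

/-! ### Growth and continuity of the shear stress -/

/-- `|v⁰ v¹| ≤ 1 + |v|²` on `ℝ³`. [folklore] -/
theorem abs_vel_zero_mul_vel_one_le (v : V3) : |v 0 * v 1| ≤ 1 + ‖v‖ ^ 2 := by
  have h0 : |v 0| ≤ ‖v‖ := by simpa [Real.norm_eq_abs] using PiLp.norm_apply_le v 0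
  have h1 : |v 1| ≤ ‖v‖ := by simpa [Real.norm_eq_abs] using PiLp.norm_apply_le v 1
  calc |v 0 * v 1| = |v 0| * |v 1| := abs_mul _ _
    _ ≤ ‖v‖ * ‖v‖ := mul_le_mul h0 h1 (abs_nonneg _) (norm_nonneg _)
    _ = ‖v‖ ^ 2 := (sq ‖v‖).symm
    _ ≤ 1 + ‖v‖ ^ 2 := le_add_of_nonneg_left zero_le_one

/-- A continuous test function on the torus gives a shear stress `φ(x) v⁰ v¹` of quadratic growth,
`|φ(x) v⁰ v¹| ≤ ‖φ‖_∞ (1 + |v|²)` (`φ` is bounded on the compact torus). [folklore] -/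
theorem exists_shear_growth_bound {φ : T3 → ℝ} (hφ : Continuous φ) :
    ∃ C : ℝ, ∀ y : T3 × V3, |φ y.1 * (y.2 0 * y.2 1)| ≤ C * (1 + ‖y.2‖ ^ 2) := by
  obtain ⟨C, hC⟩ := isCompact_univ.exists_bound_of_continuousOn (hφ.continuousOn (s := univ))
  refine ⟨C, fun y => ?_⟩
  have hφy : |φ y.1| ≤ C := by simpa [Real.norm_eq_abs] using hC y.1 (mem_univ _)
  have hC0 : 0 ≤ C := (abs_nonneg _).trans hφy
  rw [abs_mul]
  exact mul_le_mul hφy (abs_vel_zero_mul_vel_one_le y.2) (abs_nonneg _) hC0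

/-- The shear stress `(x, v) ↦ φ(x) v⁰ v¹` is continuous for continuous `φ`. [folklore] -/
theorem continuous_shearStress {φ : T3 → ℝ} (hφ : Continuous φ) :
    Continuous fun y : T3 × V3 => φ y.1 * (y.2 0 * y.2 1) := by
  fun_prop

/-! ### The reductions -/

/-- **`EquilibriumFastWindowLD → EquilibriumShearWindowLD`** (crux stmt-AtomisticToContinuum-14440 ⇒
support stmt-AtomisticToContinuum-14446): instantiate the crux at `u₀ = 0` and the kinetic shear
stress `F(x,v) = φ(x) v⁰ v¹` — continuous, of quadratic growth, and orthogonal under `M_{1,0,θ₀}` to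
`1`, `v_j`, `|v|²` by parity. [difficulty: provable-now] -/
theorem equilibriumShearWindowLD_of_equilibriumFastWindowLD
    (h : Theses.TwoClocks.EquilibriumFastWindowLD) : Theses.TwoClocks.EquilibriumShearWindowLD := by
  obtain ⟨σ₀, hσ₀, H⟩ := h
  refine ⟨σ₀, hσ₀, ?_⟩
  intro a₀ θ₀ ha hθ σ hσ hσ' Φ φ hφ
  exact H a₀ θ₀ 0 ha hθ σ hσ hσ' Φ (fun y => φ y.1 * (y.2 0 * y.2 1)) (continuous_shearStress hφ)
    (exists_shear_growth_bound hφ) (fun x => integral_shear_mul_localMaxwellian (φ x) θ₀)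
    (fun x j => integral_shear_mul_vel_mul_localMaxwellian (φ x) θ₀ j)
    (fun x => integral_shear_mul_norm_sq_mul_localMaxwellian (φ x) θ₀)

/-- The activity-ratio packing guard of the docking nodes at constant activity: for
`0 < σ < min 1 η₀` and `a ≡ a₀ > 0`, `σ³ · sup a ≤ η₀ · ∫ a` (the torus has volume one, so both
sides are `a₀` times `σ³ ≤ σ < η₀`). [folklore] -/
theorem packing_guard_const {η₀ a₀ σ : ℝ} (ha : 0 < a₀) (hσ : 0 < σ) (hσ1 : σ < 1) (hση : σ < η₀) :
    σ ^ 3 * (⨆ _x : T3, a₀) ≤ η₀ * ∫ _x : T3, a₀ := by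
  rw [ciSup_const, integral_const, smul_eq_mul, probReal_univ, one_mul]
  have hσ3 : σ ^ 3 ≤ σ := by
    calc σ ^ 3 ≤ σ ^ 1 := pow_le_pow_of_le_one hσ.le hσ1.le (by norm_num)
      _ = σ := pow_one σ
  exact mul_le_mul_of_nonneg_right (hσ3.trans hση.le) ha.le

/-- **`KineticWindowLDUniform → EquilibriumShearWindowLD`** (docking node
stmt-AtomisticToContinuum-14442 ⇒ support stmt-AtomisticToContinuum-14446): at constant profiles
`a ≡ a₀`, `u ≡ 0`, `θ ≡ θ₀` the local Gibbs law is the global one of the support item, the packing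
guard `σ³ sup a ≤ η₀ ∫ a` reads `σ³ ≤ η₀`, so the universal `σ₀ := min 1 η₀` serves; then
instantiate at the shear stress as in `equilibriumShearWindowLD_of_equilibriumFastWindowLD`.
[difficulty: provable-now] -/
theorem equilibriumShearWindowLD_of_kineticWindowLDUniform
    (h : Theses.TwoClocks.KineticWindowLDUniform) : Theses.TwoClocks.EquilibriumShearWindowLD := by
  obtain ⟨η₀, hη₀, H⟩ := h
  refine ⟨min 1 η₀, lt_min one_pos hη₀, ?_⟩
  intro a₀ θ₀ ha hθ σ hσ hσ' Φ φ hφ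
  have hσ1 : σ < 1 := hσ'.trans_le (min_le_left _ _)
  have hση : σ < η₀ := hσ'.trans_le (min_le_right _ _)
  exact H (fun _ => a₀) (fun _ => θ₀) (fun _ => 0) continuous_const continuous_const
    continuous_const (fun _ => ha) (fun _ => hθ) σ hσ (packing_guard_const ha hσ hσ1 hση) Φ
    (fun y => φ y.1 * (y.2 0 * y.2 1)) (continuous_shearStress hφ) (exists_shear_growth_bound hφ)
    (fun x => integral_shear_mul_localMaxwellian (φ x) θ₀)
    (fun x j => integral_shear_mul_vel_mul_localMaxwellian (φ x) θ₀ j)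
    (fun x => integral_shear_mul_norm_sq_mul_localMaxwellian (φ x) θ₀)

end Summit.AtomisticToContinuum.HydrodynamicLimit.Theorems

end
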